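import Literature.NumberTheory.Automorphic.MixedSpaceUnitsIntegration
import Mathlib.Analysis.SpecialFunctions.Pow.Complex
import Mathlib.MeasureTheory.Integral.IntervalIntegral.Basic
import HarnessLib

/-!
# Mellin transforms over `K_∞ˣ` of product functions

Topic `NumberTheory/Automorphic`; namespace `Literature.NumberTheory.Automorphic`. Theorems only (no
definition, no named fact, no instance). The measure-theoretic half of "the archimedean Hecke integral
of a pure tensor is the product of the local integrals" (Jacquet–Langlands (1970), proof of Thm. 11.1,
p. 173; Tate (1967), §4.3): for a Haar measure `μ` on `K_∞ˣ` there is `c_μ > 0` such that for all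
`F_w : ℝ → ℂ` (`w` real), `G_w : ℂ → ℂ` (`w` complex) and `s ∈ ℂ` with the one-variable integrands
integrable,

  `∫_{K_∞ˣ} (∏_w F_w(u_w) ∏_w G_w(u_w)) N(u)^{s - 1/2} dμ(u)
      = c_μ · ∏_w ∫_ℝ F_w(t) |t|^{s - 3/2} dt · ∏_w ∫_ℂ G_w(z) (|z|²)^{s - 3/2} dx dy`

and the integrand on the left is `μ`-integrable (`integrable_and_integral_units_prod_mul_norm_cpow`:
`d^×u = c_μ dx/N(x)`, `N(x) = ∏|x_w| ∏|z_w|²`, Fubini). The one-variable integrals are brought to Mellin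
form by `integral_real_eq_integral_Ioi_add_comp_neg` (`∫_ℝ f = ∫₀^∞ (f(t) + f(-t)) dt`) and the tree's
`integral_complex_radial` (`∫_ℂ H(|z|) = 2π ∫₀^∞ r H(r) dr`).

## References

* H. Jacquet, R. P. Langlands, *Automorphic Forms on GL(2)*, LNM 114 (1970), proof of Thm. 11.1, p. 173.
  [JacquetLanglands1970]
* J. Tate, *Fourier analysis in number fields and Hecke's zeta-functions* (1967), §4.3. [TateThesis1967]
-/

noncomputable section

open MeasureTheory Measure NumberField NumberField.InfinitePlace NumberField.mixedEmbedding Set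
open scoped ENNReal NNReal Classical

namespace Literature.NumberTheory.Automorphic

/-! ### Scalar lemmas -/

/-- `(∏ a_i)^r = ∏ a_i^r` for non-negative reals `a_i` and a complex exponent. [folklore] -/
theorem ofReal_prod_cpow {ι : Type*} (s : Finset ι) (a : ι → ℝ) (ha : ∀ i ∈ s, 0 ≤ a i) (r : ℂ) :
    (((∏ i ∈ s, a i : ℝ)) : ℂ) ^ r = ∏ i ∈ s, ((a i : ℝ) : ℂ) ^ r := by
  induction s using Finset.induction_on with
  | empty => simp
  | @insert j s hj ih =>
    rw [Finset.prod_insert hj, Finset.prod_insert hj, Complex.ofReal_mul,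
      Complex.mul_cpow_ofReal_nonneg (ha j (Finset.mem_insert_self j s))
        (Finset.prod_nonneg fun i hi => ha i (Finset.mem_insert_of_mem hi)),
      ih fun i hi => ha i (Finset.mem_insert_of_mem hi)]

/-- `a^r / a = a^{r-1}` for a positive real `a`. [folklore] -/
theorem ofReal_cpow_mul_inv {a : ℝ} (ha : 0 < a) (r : ℂ) :
    ((a : ℝ) : ℂ) ^ r * ((a : ℝ) : ℂ)⁻¹ = ((a : ℝ) : ℂ) ^ (r - 1) := by
  have ha' : ((a : ℝ) : ℂ) ≠ 0 := Complex.ofReal_ne_zero.2 ha.ne'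
  rw [Complex.cpow_sub _ _ ha', Complex.cpow_one, div_eq_mul_inv]

/-- **`∫_ℝ f = ∫₀^∞ (f(t) + f(-t)) dt`** for an integrable `f`. [folklore] -/
theorem integral_real_eq_integral_Ioi_add_comp_neg {E : Type*} [NormedAddCommGroup E] [NormedSpace ℝ E]
    {f : ℝ → E} (hf : Integrable f) :
    ∫ t, f t = ∫ t in Ioi (0 : ℝ), (f t + f (-t)) := by
  have h1 : IntegrableOn (fun t => f (-t)) (Ioi (0 : ℝ)) := hf.comp_neg.integrableOn
  rw [integral_add hf.integrableOn h1, integral_comp_neg_Ioi, neg_zero, add_comm,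
    intervalIntegral.integral_Iic_add_Ioi hf.integrableOn hf.integrableOn]

variable (K : Type*) [Field K] [NumberField K]

/-- `N(x) = ∏_{w real} |x_w| · ∏_{w complex} |z_w|²`. [folklore] -/
theorem norm_eq_prod_mul_prod (x : mixedSpace K) :
    mixedEmbedding.norm x = (∏ w : {w : InfinitePlace K // IsReal w}, ‖x.1 w‖) *
      ∏ w : {w : InfinitePlace K // IsComplex w}, ‖x.2 w‖ ^ 2 := by
  rw [mixedEmbedding.norm_apply, prod_eq_prod_mul_prod]
  congr 1
  · exact Finset.prod_congr rfl fun w _ => by rw [normAtPlace_apply_of_isReal w.prop, mult_isReal, pow_one]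
  · exact Finset.prod_congr rfl fun w _ => by rw [normAtPlace_apply_of_isComplex w.prop, mult_isComplex]

/-- `N(x)^r = ∏_w |x_w|^r · ∏_w (|z_w|²)^r` (complex powers of the non-negative factors). [folklore] -/
theorem ofReal_norm_cpow_eq_prod (x : mixedSpace K) (r : ℂ) :
    ((mixedEmbedding.norm x : ℝ) : ℂ) ^ r =
      (∏ w, ((‖x.1 w‖ : ℝ) : ℂ) ^ r) * ∏ w, ((‖x.2 w‖ ^ 2 : ℝ) : ℂ) ^ r := by
  rw [norm_eq_prod_mul_prod, Complex.ofReal_mul,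
    Complex.mul_cpow_ofReal_nonneg (Finset.prod_nonneg fun w _ => norm_nonneg _)
      (Finset.prod_nonneg fun w _ => by positivity),
    ofReal_prod_cpow _ _ (fun w _ => norm_nonneg _), ofReal_prod_cpow _ _ (fun w _ => by positivity)]

attribute [local instance] Literature.MeasureTheory.Group.Units.borelSpace_of_isOpenEmbedding
  Literature.MeasureTheory.Group.hasSummableGeomSeries_of_finiteDimensional

/-- The pointwise identity behind the product formula: for `x ∈ K_∞` with all coordinates non-zero,
`N(x)⁻¹ · (∏ F_w(x_w) ∏ G_w(z_w)) N(x)^{s-1/2} = ∏ F_w(x_w)|x_w|^{s-3/2} · ∏ G_w(z_w)(|z_w|²)^{s-3/2}`. [folklore] -/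
theorem norm_inv_smul_prod_mul_norm_cpow (F : {w : InfinitePlace K // IsReal w} → ℝ → ℂ)
    (G : {w : InfinitePlace K // IsComplex w} → ℂ → ℂ) (s : ℂ) {x : mixedSpace K}
    (h1 : ∀ w, x.1 w ≠ 0) (h2 : ∀ w, x.2 w ≠ 0) :
    (mixedEmbedding.norm x)⁻¹ • (((∏ w, F w (x.1 w)) * ∏ w, G w (x.2 w)) *
        ((mixedEmbedding.norm x : ℝ) : ℂ) ^ (s - 1 / 2)) =
      (∏ w, F w (x.1 w) * ((|x.1 w| : ℝ) : ℂ) ^ (s - 3 / 2)) *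
        ∏ w, G w (x.2 w) * ((‖x.2 w‖ ^ 2 : ℝ) : ℂ) ^ (s - 3 / 2) := by
  have hsub : s - 3 / 2 = (s - 1 / 2) - 1 := by ring
  rw [Complex.real_smul, Complex.ofReal_inv, ofReal_norm_cpow_eq_prod, norm_eq_prod_mul_prod,
    Complex.ofReal_mul, Complex.ofReal_prod, Complex.ofReal_prod, mul_inv, hsub]
  have hr : ∀ w, F w (x.1 w) * ((|x.1 w| : ℝ) : ℂ) ^ (s - 1 / 2 - 1) =
      (((‖x.1 w‖ : ℝ) : ℂ))⁻¹ * (F w (x.1 w) * ((‖x.1 w‖ : ℝ) : ℂ) ^ (s - 1 / 2)) := fun w => by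
    rw [Real.norm_eq_abs, ← ofReal_cpow_mul_inv (abs_pos.2 (h1 w))]; ring
  have hc : ∀ w, G w (x.2 w) * ((‖x.2 w‖ ^ 2 : ℝ) : ℂ) ^ (s - 1 / 2 - 1) =
      (((‖x.2 w‖ ^ 2 : ℝ) : ℂ))⁻¹ * (G w (x.2 w) * ((‖x.2 w‖ ^ 2 : ℝ) : ℂ) ^ (s - 1 / 2)) := fun w => by
    rw [← ofReal_cpow_mul_inv (pow_pos (norm_pos_iff.2 (h2 w)) 2)]; ring
  simp_rw [hr, hc, Finset.prod_mul_distrib, Finset.prod_inv_distrib]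
  ring

/-- **Mellin transforms over `K_∞ˣ` of product functions.** For a Haar measure `μ` on `K_∞ˣ` there is
`c_μ > 0` such that, for all `F_w`, `G_w`, `s` with `t ↦ F_w(t)|t|^{s-3/2}` integrable on `ℝ` and
`z ↦ G_w(z)(|z|²)^{s-3/2}` integrable on `ℂ`, the function `u ↦ (∏ F_w(u_w) ∏ G_w(u_w)) N(u)^{s-1/2}` is
`μ`-integrable on `K_∞ˣ` and
`∫ (∏ F_w ∏ G_w) N^{s-1/2} dμ = c_μ ∏_w ∫_ℝ F_w(t)|t|^{s-3/2} dt ∏_w ∫_ℂ G_w(z)(|z|²)^{s-3/2}`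
(`d^×u = c_μ dx/N(x)`, Fubini). [cite: JacquetLanglands1970, proof of Thm. 11.1, p. 173] [cite: TateThesis1967, §4.3] -/
theorem integrable_and_integral_units_prod_mul_norm_cpow (μ : Measure (mixedSpace K)ˣ) [μ.IsHaarMeasure] :
    ∃ c : ℝ, 0 < c ∧ ∀ (F : {w : InfinitePlace K // IsReal w} → ℝ → ℂ)
      (G : {w : InfinitePlace K // IsComplex w} → ℂ → ℂ) (s : ℂ),
      (∀ w, Measurable (F w)) → (∀ w, Measurable (G w)) →
      (∀ w, Integrable fun t : ℝ => F w t * ((|t| : ℝ) : ℂ) ^ (s - 3 / 2)) →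
      (∀ w, Integrable fun z : ℂ => G w z * ((‖z‖ ^ 2 : ℝ) : ℂ) ^ (s - 3 / 2)) →
      Integrable (fun u : (mixedSpace K)ˣ =>
        ((∏ w, F w ((u : mixedSpace K).1 w)) * ∏ w, G w ((u : mixedSpace K).2 w)) *
          ((mixedEmbedding.norm (u : mixedSpace K) : ℝ) : ℂ) ^ (s - 1 / 2)) μ ∧
      ∫ u : (mixedSpace K)ˣ, ((∏ w, F w ((u : mixedSpace K).1 w)) * ∏ w, G w ((u : mixedSpace K).2 w)) *
          ((mixedEmbedding.norm (u : mixedSpace K) : ℝ) : ℂ) ^ (s - 1 / 2) ∂μ =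
        c * ((∏ w, ∫ t : ℝ, F w t * ((|t| : ℝ) : ℂ) ^ (s - 3 / 2)) *
          ∏ w, ∫ z : ℂ, G w z * ((‖z‖ ^ 2 : ℝ) : ℂ) ^ (s - 3 / 2)) := by
  obtain ⟨c, hc, hint⟩ := exists_integral_units_eq_mul_integral K μ
  refine ⟨c, hc, fun F G s hFm hGm hF hG => ?_⟩
  -- the integrand as a function on `K_∞`
  set Φ : mixedSpace K → ℂ := fun x => ((∏ w, F w (x.1 w)) * ∏ w, G w (x.2 w)) *
    ((mixedEmbedding.norm x : ℝ) : ℂ) ^ (s - 1 / 2) with hΦ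
  set Ψ : mixedSpace K → ℂ := fun x => (∏ w, F w (x.1 w) * ((|x.1 w| : ℝ) : ℂ) ^ (s - 3 / 2)) *
    ∏ w, G w (x.2 w) * ((‖x.2 w‖ ^ 2 : ℝ) : ℂ) ^ (s - 3 / 2) with hΨ
  have hae : (fun x => (mixedEmbedding.norm x)⁻¹ • Φ x) =ᵐ[volume] Ψ := by
    have h1 : ∀ᵐ x : mixedSpace K, ∀ w, x.1 w ≠ 0 := by
      rw [ae_all_iff]; intro w
      have h := volume_setOf_fst_eq_zero K w
      rw [ae_iff]; simpa using h
    have h2 : ∀ᵐ x : mixedSpace K, ∀ w, x.2 w ≠ 0 := by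
      rw [ae_all_iff]; intro w
      have h := volume_setOf_snd_eq_zero K w
      rw [ae_iff]; simpa using h
    filter_upwards [h1, h2] with x hx1 hx2
    exact norm_inv_smul_prod_mul_norm_cpow K F G s hx1 hx2
  -- integrability of `Ψ` on `K_∞` (product of integrable one-variable functions)
  have hΨi : Integrable Ψ := by
    have hA : Integrable (fun a : {w : InfinitePlace K // IsReal w} → ℝ =>
        ∏ w, F w (a w) * ((|a w| : ℝ) : ℂ) ^ (s - 3 / 2)) :=
      Integrable.fintype_prod (f := fun w t => F w t * ((|t| : ℝ) : ℂ) ^ (s - 3 / 2)) hF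
    have hB : Integrable (fun b : {w : InfinitePlace K // IsComplex w} → ℂ =>
        ∏ w, G w (b w) * ((‖b w‖ ^ 2 : ℝ) : ℂ) ^ (s - 3 / 2)) :=
      Integrable.fintype_prod (f := fun w z => G w z * ((‖z‖ ^ 2 : ℝ) : ℂ) ^ (s - 3 / 2)) hG
    have h := hA.mul_prod hB
    rw [← MeasureTheory.Measure.volume_eq_prod] at h
    exact h
  -- measurability of `Φ`
  have hΦm : Measurable Φ := by
    refine Measurable.mul (Measurable.mul ?_ ?_) ?_
    · exact Finset.measurable_prod _ fun w _ => (hFm w).comp ((measurable_pi_apply w).comp measurable_fst)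
    · exact Finset.measurable_prod _ fun w _ => (hGm w).comp ((measurable_pi_apply w).comp measurable_snd)
    · exact ((Complex.continuous_ofReal.measurable.comp (mixedEmbedding.continuous_norm K).measurable).pow_const _)
  refine ⟨?_, ?_⟩
  · -- integrability on `K_∞ˣ`
    have hnorm : Integrable (fun u : (mixedSpace K)ˣ => ‖Φ (u : mixedSpace K)‖) μ := by
      refine Literature.MeasureTheory.Group.integrable_comp_val_of_integrable volume μ hΦm.norm ?_
      have hΨn : Integrable (fun x => ‖Ψ x‖) := hΨi.norm
      have hae' : (fun x => |(Algebra.norm ℝ x)⁻¹| * ‖Φ x‖) =ᵐ[volume] fun x => ‖Ψ x‖ := by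
        filter_upwards [hae] with x hx
        rw [← hx, _root_.norm_smul, Real.norm_eq_abs, abs_inv, abs_inv, Literature.RingTheory.Norm.abs_algebraNorm_mixedSpace,
          abs_of_nonneg (mixedEmbedding.norm_nonneg x)]
      exact (hΨn.congr hae'.symm).integrableOn
    exact (integrable_norm_iff ((hΦm.comp
      Literature.MeasureTheory.Group.measurableEmbedding_unitsVal.measurable).aestronglyMeasurable)).1 hnorm
  · -- the value
    have h3 : ∫ x, Ψ x = (∏ w, ∫ t : ℝ, F w t * ((|t| : ℝ) : ℂ) ^ (s - 3 / 2)) *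
        ∏ w, ∫ z : ℂ, G w z * ((‖z‖ ^ 2 : ℝ) : ℂ) ^ (s - 3 / 2) :=
      integral_mixedSpace_prod_eq_prod K (fun w t => F w t * ((|t| : ℝ) : ℂ) ^ (s - 3 / 2))
        (fun w z => G w z * ((‖z‖ ^ 2 : ℝ) : ℂ) ^ (s - 3 / 2))
    rw [hint Φ, integral_congr_ae hae, h3, Complex.real_smul]

end Literature.NumberTheory.Automorphic
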